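import Summits.QuantumAdvantage.QuantumAdvantage.Theorems.SparsityDialMP6

/-!
# SparsityDial — part MP7 of 10 of the «MovingPointers» package (decomp-qadv lens 2, g18): §C3–§C5 affine-pointers loss `AffinePointersLoss3` (PROVED, no separation) + S-form

Imports its predecessor `SparsityDialMP6` (linear chain MP1 → … → MP10); the package overview is the module docstring of `SparsityDialMP1`.
No `sorry`; standard axioms; no instances / notation.
-/

set_option linter.unusedVariables false
set_option linter.dupNamespace false

noncomputable section
open scoped Classical

namespace Summit.QuantumAdvantage.QuantumAdvantage.Theorems.SparsityDial

open Finset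
open Literature.Computability.QuantumComplexity Literature.Computability.QuantumComplexity.RingHLF
open Literature.Computability.MetaComplexity Literature.Computability.MetaComplexity.Smolensky
open Summit.QuantumAdvantage.AdviceFreeQNC0
open Summit.QuantumAdvantage.QuantumAdvantage.Theorems.HolonomyDial (gCond)
open Summit.QuantumAdvantage.QuantumAdvantage.Theorems.LocusDial
open Summit.QuantumAdvantage.QuantumAdvantage.Theorems.AnchorDial (dev outB win_iff card_odd_ge)
open Summit.QuantumAdvantage.QuantumAdvantage.Theorems.HolonomyDial (card_odd_le)
open Summit.QuantumAdvantage.QuantumAdvantage.Theorems.StabilizerDial (eventually_polylog StabFew stabFew_of_fewLocus)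

/-! ## §C3  Counting the losers without any separation between the pointers -/

section AnyCount
variable {N t : ℕ}

/-- SparsityDial «MovingPointers» helper `fibre_losers_any_ge` (decomp-qadv lens-2 g18 land package; see the module docstring). -/
theorem fibre_losers_any_ge (M : Fin t → Fin N → ZMod 3) (v : Fin t → ZMod 3) {m : ℕ} (k : Fin m → ℕ)
    (B : ℝ) (hB0 : 0 ≤ B) (hB : ∀ α a : Fin m → ZMod 3, (∑ l, α l) ≠ 0 → ‖fibSumM M v α a k‖ ≤ B) :
    ((fib M v).card : ℝ) ≤
      3 * ((fib M v).filter (fun x =>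
        Even ((univ : Finset (Fin m)).filter (fun l => kph x (k l) ≠ 2)).card)).card + 3 ^ (m + 1) * B := by
  set cell : (Fin m → ZMod 3) → ℝ := fun a => (((fib M v).filter (fun x => ∀ l, kph x (k l) = a l)).card : ℝ)
    with hcell
  set Lf := (fib M v).filter (fun x =>
        Even ((univ : Finset (Fin m)).filter (fun l => kph x (k l) ≠ 2)).card) with hLf
  set E := evenCells m with hEdef
  have htot : ((fib M v).card : ℝ) = ∑ b : Fin m → ZMod 3, cell b := by
    have h := card_eq_sum_card_fiberwise (f := fun x => (fun l => kph x (k l))) (s := fib M v)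
      (t := (univ : Finset (Fin m → ZMod 3))) (fun x _ => mem_univ _)
    rw [h]
    push_cast
    apply sum_congr rfl
    intro b _
    simp only [hcell]
    congr 2
    ext x
    simp only [mem_filter]
    constructor
    · rintro ⟨hx, hfx⟩
      exact ⟨hx, fun l => congrFun hfx l⟩
    · rintro ⟨hx, hl⟩
      exact ⟨hx, funext hl⟩
  have hfib : Lf.card = ∑ a ∈ E, ((fib M v).filter (fun x => ∀ l, kph x (k l) = a l)).card := by
    rw [card_eq_sum_card_fiberwise (f := fun x => (fun l => kph x (k l))) (s := Lf) (t := E) ?_]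
    · apply sum_congr rfl
      intro a ha
      have ha' : Even ((univ : Finset (Fin m)).filter (fun l => a l ≠ 2)).card := by
        rw [hEdef] at ha; unfold evenCells at ha; rw [mem_filter] at ha; exact ha.2
      congr 1
      ext x
      simp only [hLf, mem_filter]
      constructor
      · rintro ⟨⟨hx, _⟩, hfx⟩
        exact ⟨hx, fun l => congrFun hfx l⟩
      · rintro ⟨hx, hl⟩
        have hfx : (fun l => kph x (k l)) = a := funext hl
        refine ⟨⟨hx, ?_⟩, hfx⟩
        have hset : (univ : Finset (Fin m)).filter (fun l => kph x (k l) ≠ 2) =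
            (univ : Finset (Fin m)).filter (fun l => a l ≠ 2) :=
          filter_congr (fun l _ => by rw [hl l])
        rw [hset]; exact ha'
    · intro x hx
      rw [hLf, coe_filter] at hx
      rw [hEdef]
      unfold evenCells
      rw [coe_filter]
      exact ⟨mem_univ _, hx.2⟩
  have hLfR : (Lf.card : ℝ) = ∑ a ∈ E, cell a := by
    rw [hfib]; push_cast; rfl
  have hline : ∀ a : Fin m → ZMod 3, ∑ γ : ZMod 3, cell (fun l => a l - γ) ≤ 3 * cell a + 3 * B :=
    fun a => line_le_cell M v a k B hB0 (fun α hα => hB α a hα)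
  have hcov : ∑ b : Fin m → ZMod 3, cell b ≤ ∑ a ∈ E, ∑ γ : ZMod 3, cell (fun l => a l - γ) := by
    rw [hEdef]
    exact cover_sum_le cell (fun b => by simp only [hcell]; positivity)
  have hs := sum_le_sum (fun a (_ : a ∈ E) => hline a)
  rw [sum_add_distrib, ← mul_sum, sum_const, nsmul_eq_mul] at hs
  have hEle : (E.card : ℝ) ≤ 3 ^ m := by
    have h1 : E.card ≤ (univ : Finset (Fin m → ZMod 3)).card := by
      rw [hEdef]; unfold evenCells; exact card_filter_le _ _
    rw [card_univ, Fintype.card_fun, ZMod.card, Fintype.card_fin] at h1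
    exact_mod_cast h1
  rw [htot, hLfR, pow_succ]
  nlinarith [hcov, hs, hEle, hB0]

/-- **global count, no separation**: `#odd ≤ 3·#{odd : EVEN number of good deviations} + 2^N/144`. -/
theorem any_losers_ge (M : Fin t → Fin N → ZMod 3) {m : ℕ} (hm : 1 ≤ m) (π : (Fin t → ZMod 3) → Fin m → ℕ)
    (j : ℕ) (h2j : ∀ v l, 2 * j ≤ π v l) (hkN : ∀ v l, π v l + 1 ≤ N) (hjt : 8 * (t + m + 3) + 20 ≤ j) :
    ((univ.filter fun x : Fin N → Bool => OddZeros x).card : ℝ) ≤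
      3 * ((univ.filter fun x : Fin N → Bool => OddZeros x ∧
        Even ((univ : Finset (Fin m)).filter (fun l => kph x (π (linHash M x) l) ≠ 2)).card).card : ℝ) +
        2 ^ N / 144 := by
  set Odd := (univ : Finset (Fin N → Bool)).filter (fun x => OddZeros x) with hOdd
  set L := univ.filter fun x : Fin N → Bool => OddZeros x ∧
        Even ((univ : Finset (Fin m)).filter (fun l => kph x (π (linHash M x) l) ≠ 2)).card with hL
  have hOdd_fib : Odd.card = ∑ v : Fin t → ZMod 3, (fib M v).card := by
    rw [card_eq_sum_card_fiberwise (f := fun x => linHash M x) (t := (univ : Finset (Fin t → ZMod 3)))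
      (fun x _ => mem_univ _)]
    rfl
  have hL_fib : L.card = ∑ v : Fin t → ZMod 3, ((fib M v).filter (fun x =>
      Even ((univ : Finset (Fin m)).filter (fun l => kph x (π v l) ≠ 2)).card)).card := by
    rw [card_eq_sum_card_fiberwise (f := fun x => linHash M x) (t := (univ : Finset (Fin t → ZMod 3)))
      (fun x _ => mem_univ _)]
    apply sum_congr rfl
    intro v _
    congr 1
    rw [hL]
    unfold fib
    ext x
    simp only [mem_filter, mem_univ, true_and]
    constructor
    · rintro ⟨⟨hx, hk⟩, hv⟩
      exact ⟨⟨hx, hv⟩, by rw [← hv]; exact hk⟩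
    · rintro ⟨⟨hx, hv⟩, hk⟩
      exact ⟨⟨hx, by rw [hv]; exact hk⟩, hv⟩
  have hfib : ∀ v : Fin t → ZMod 3, ((fib M v).card : ℝ) ≤
      3 * ((fib M v).filter (fun x =>
        Even ((univ : Finset (Fin m)).filter (fun l => kph x (π v l) ≠ 2)).card)).card +
        3 ^ (m + 1) * (2 ^ N / (432 * 3 ^ m * 3 ^ t)) := by
    intro v
    apply fibre_losers_any_ge M v (π v) (2 ^ N / (432 * 3 ^ m * 3 ^ t)) (by positivity)
    intro α a hα
    have hb := fibSumM_bound_prefix M v α a hα (π v) j (h2j v) (hkN v) hm hjt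
    rw [le_div_iff₀ (by positivity)]
    linarith
  have hs := sum_le_sum (fun v (_ : v ∈ (univ : Finset (Fin t → ZMod 3))) => hfib v)
  rw [sum_add_distrib, ← mul_sum, sum_const, card_univ, Fintype.card_fun, ZMod.card, Fintype.card_fin,
    nsmul_eq_mul] at hs
  push_cast at hs
  have e : (3 : ℝ) ^ t * (3 ^ (m + 1) * (2 ^ N / (432 * 3 ^ m * 3 ^ t))) = 2 ^ N / 144 := by
    rw [pow_succ]
    field_simp
    ring
  rw [hOdd_fib, hL_fib]
  push_cast
  linarith

end AnyCount

/-! ## §C4  THE AFFINE-POINTERS LOSS THEOREM (no separation, no sortedness) and the rung `AffinePointersLoss3` (PROVED) -/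

section AnyStrategy
variable {N t : ℕ}

/-- **THE AFFINE-POINTERS LOSS THEOREM**: deviation set = the image of ANY injective `m`-tuple of positions `≥ 2j`
looked up (by arbitrary functions) from an `𝔽₃`-linear hash with `t` forms, `8(t+m+3) + 20 ≤ j`
⇒ `#odd ≤ 4·#{odd losers}` — the pointers may be ADJACENT, CLUSTERED, in any order. -/
theorem affinePointers_loss (hN : 3 ≤ N) (M : Fin t → Fin N → ZMod 3) {m : ℕ} (π : (Fin t → ZMod 3) → Fin m → Fin N)
    (j : ℕ) (hinj : ∀ v, Function.Injective (π v)) (h2j : ∀ v l, 2 * j ≤ (π v l).val)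
    (hjt : 8 * (t + m + 3) + 20 ≤ j) (P : Fin N → CubeFn (ZMod 3) N)
    (hdev : ∀ x, OddZeros x → dev P x = univ.image (π (linHash M x))) :
    (univ.filter fun x : Fin N → Bool => OddZeros x).card ≤
      4 * (univ.filter fun x : Fin N → Bool => OddZeros x ∧ ¬ Rel x (outB P x)).card := by
  have hlos : (univ.filter fun x : Fin N → Bool => OddZeros x ∧ ¬ Rel x (outB P x)) =
      univ.filter fun x : Fin N → Bool => OddZeros x ∧
        Even ((univ : Finset (Fin m)).filter (fun l => kph x (π (linHash M x) l).val ≠ 2)).card := by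
    apply filter_congr
    intro x _
    exact and_congr_right (fun hx => lose_iff_of_dev_image hN P x hx _ (hinj _) (hdev x hx))
  rw [hlos]
  by_cases hm : m = 0
  · subst hm
    have hall : (univ.filter fun x : Fin N → Bool => OddZeros x) ⊆
        univ.filter fun x : Fin N → Bool => OddZeros x ∧
          Even ((univ : Finset (Fin 0)).filter (fun l => kph x (π (linHash M x) l).val ≠ 2)).card := by
      intro x hx
      rw [mem_filter] at hx ⊢
      refine ⟨hx.1, hx.2, ?_⟩
      simp
    have := card_le_card hall
    omega
  have hm1 : 1 ≤ m := Nat.one_le_iff_ne_zero.mpr hm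
  have h5 := any_losers_ge M hm1 (fun v l => (π v l).val) j h2j (fun v l => by have := (π v l).isLt; omega) hjt
  set O := (univ.filter fun x : Fin N → Bool => OddZeros x).card with hO
  set L := (univ.filter fun x : Fin N → Bool => OddZeros x ∧
        Even ((univ : Finset (Fin m)).filter (fun l => kph x (π (linHash M x) l).val ≠ 2)).card).card with hL
  have hOge : 2 ^ (N - 1) ≤ O := card_odd_ge (by omega)
  have hOge' : (2 : ℝ) ^ (N - 1) ≤ O := by exact_mod_cast hOge
  have hpow : (2 : ℝ) ^ N = 2 * 2 ^ (N - 1) := by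
    rw [← pow_succ']; congr 1; omega
  have h5' : (O : ℝ) ≤ 3 * (L : ℝ) + 2 ^ N / 144 := h5
  have hreal : (O : ℝ) ≤ 4 * L := by
    rw [hpow] at h5'
    nlinarith [h5', hOge']
  exact_mod_cast hreal

/-- **the rung `AffinePointersLoss3`**: every strategy whose deviation set is the image of an INJECTIVE tuple of
`m ≤ (log₂ n)^c` positions `≥ n/(4(log₂ n)^c)` (otherwise ARBITRARY: adjacent, clustered, unsorted), looked up by
arbitrary functions from an `𝔽₃`-linear hash with `t ≤ (log₂ n)^c` forms, wins on at most `(1 − n^{-C})·2^{n−1}` odd inputs. -/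
def AffinePointersLoss3 : Prop := ∃ C : ℕ, ∀ c : ℕ, ∃ n₀ : ℕ, ∀ n ≥ n₀, ∀ t ≤ (Nat.log 2 n) ^ c,
  ∀ m ≤ (Nat.log 2 n) ^ c, ∀ (M : Fin t → Fin n → ZMod 3) (π : (Fin t → ZMod 3) → Fin m → Fin n),
    (∀ v, Function.Injective (π v)) → (∀ v l, n / (4 * (Nat.log 2 n) ^ c) ≤ (π v l).val) →
    ∀ P : Fin n → CubeFn (ZMod 3) n, (∀ x, OddZeros x → dev P x = univ.image (π (linHash M x))) →
      ((univ.filter fun x : Fin n → Bool => OddZeros x ∧ Rel x (fun i => decide (P i x = 1))).card : ℝ) ≤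
        (1 - 1 / (n : ℝ) ^ C) * (2 : ℝ) ^ (n - 1)

/-- **`AffinePointersLoss3` PROVED** (`C = 1`). -/
theorem affinePointersLoss3 : AffinePointersLoss3 := by
  refine ⟨1, fun c => ?_⟩
  obtain ⟨n₀, hn₀⟩ := eventually_polylog 480 (2 * c)
  refine ⟨n₀, fun n hn t ht m hmle M π hinj hfirst P hdev => ?_⟩
  obtain ⟨hK, hL⟩ := hn₀ n hn
  set A := (Nat.log 2 n) ^ c with hA
  have hA1 : 1 ≤ A := Nat.one_le_pow _ _ (by omega)
  have hA2 : (Nat.log 2 n) ^ (2 * c) = A * A := by rw [hA, ← pow_add]; ring_nf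
  rw [hA2] at hK
  have hn2 : 480 * (A * A) ≤ n := le_trans hK (Nat.div_le_self n 2)
  have h4 : 4 ≤ n := by nlinarith
  have h3 : 3 ≤ n := by omega
  set d := n / (4 * A) with hd
  have hdA : d * (4 * A) ≤ n := Nat.div_mul_le_self n (4 * A)
  have hdge : 32 * A + 88 ≤ d := by
    rw [hd, Nat.le_div_iff_mul_le (by omega)]
    nlinarith
  set j := d / 2 with hj
  have hjt : 8 * (t + m + 3) + 20 ≤ j := by omega
  have h2jd : 2 * j ≤ d := by omega
  have hq := affinePointers_loss (N := n) h3 M π j hinj (fun v l => le_trans h2jd (hfirst v l)) hjt P hdev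
  exact real_loss_of_frac (M := 4) (by norm_num) (by omega) h3 P hq

/-- REV 5 ⊇ REV 4 by name: sortedness with gaps `≥ n/(4(log₂ n)^c) ≥ 1` gives injectivity. -/
theorem multi_of_any (h : AffinePointersLoss3) : AffineMultiPointerLoss3 := by
  obtain ⟨C, hC⟩ := h
  refine ⟨C, fun c => ?_⟩
  obtain ⟨n₀, hn₀⟩ := hC c
  obtain ⟨n₁, hn₁⟩ := eventually_polylog 8 c
  refine ⟨max n₀ n₁, fun n hn t ht m hm M π hfirst hmono hgap P hdev => ?_⟩
  obtain ⟨hK, hL⟩ := hn₁ n (le_of_max_le_right hn)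
  set A := (Nat.log 2 n) ^ c with hA
  have hA1 : 1 ≤ A := Nat.one_le_pow _ _ (by omega)
  set d := n / (4 * A) with hd
  have hd1 : 1 ≤ d := by
    rw [hd, Nat.le_div_iff_mul_le (by omega)]
    have := Nat.div_le_self n 2
    omega
  have hinj : ∀ v, Function.Injective (π v) := by
    intro v l l' h
    by_contra hne
    rcases lt_or_gt_of_ne hne with hlt | hlt
    · have hl1 : l.val + 1 ≤ l'.val := by rw [Fin.lt_def] at hlt; omega
      have hm' : l.val + 1 < m := by have := l'.isLt; omega
      have h1 := hgap v l ⟨l.val + 1, hm'⟩ rfl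
      have h2 := hmono v ⟨l.val + 1, hm'⟩ l' (by rw [Fin.le_def]; exact hl1)
      have h3 : (π v l).val = (π v l').val := by rw [h]
      rw [Fin.le_def] at h2
      omega
    · have hl1 : l'.val + 1 ≤ l.val := by rw [Fin.lt_def] at hlt; omega
      have hm' : l'.val + 1 < m := by have := l.isLt; omega
      have h1 := hgap v l' ⟨l'.val + 1, hm'⟩ rfl
      have h2 := hmono v ⟨l'.val + 1, hm'⟩ l (by rw [Fin.le_def]; exact hl1)
      have h3 : (π v l).val = (π v l').val := by rw [h]
      rw [Fin.le_def] at h2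
      omega
  exact hn₀ n (le_of_max_le_left hn) t ht m hm M π hinj hfirst P hdev

end AnyStrategy

/-! ## §C5  The S-restricted statement: LITERALLY below piece S, and PROVED — S decided on the whole AFFINE-LOOKUP class -/

section AnySRung
variable {N t : ℕ}

/-- **`AffinePointersLossS3`** — the affine-pointers family under piece S's own hypotheses, in the `∀ c, ∃ C` order
(a consequence of `SparseGenericLoss3` at scale `a := c` by name). -/
def AffinePointersLossS3 : Prop := ∀ c : ℕ, ∃ C : ℕ, ∃ n₀ : ℕ, ∀ n ≥ n₀, ∀ t ≤ (Nat.log 2 n) ^ c,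
  ∀ m ≤ (Nat.log 2 n) ^ c, ∀ (M : Fin t → Fin n → ZMod 3) (π : (Fin t → ZMod 3) → Fin m → Fin n),
    (∀ v, Function.Injective (π v)) → (∀ v l, n / (4 * (Nat.log 2 n) ^ c) ≤ (π v l).val) →
    ∀ P : Fin n → CubeFn (ZMod 3) n, (∀ i, P i ∈ lowDeg (ZMod 3) n ((Nat.log 2 n) ^ c)) →
      ¬ StabFew 1 0 (c + 1) P →
      (∀ x, OddZeros x → dev P x = univ.image (π (linHash M x))) →
      ((univ.filter fun x : Fin n → Bool => OddZeros x ∧ Rel x (fun i => decide (P i x = 1))).card : ℝ) ≤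
        (1 - 1 / (n : ℝ) ^ C) * (2 : ℝ) ^ (n - 1)

/-- BY NAME: piece S (landed `Theorems.SparsityDial.SparseGenericLoss3`) implies the S-restricted affine-pointers statement. -/
theorem anyS_of_sparse (hS : SparseGenericLoss3) : AffinePointersLossS3 := by
  intro c
  obtain ⟨C, hC⟩ := hS c
  obtain ⟨n₀, hn₀⟩ := hC c
  refine ⟨C, n₀, fun n hn t ht m hm M π h1 h2 P hdeg hnot hdev => ?_⟩
  exact hn₀ n hn P hdeg (stabFew_of_fewLocus (c + 1) (fewLocus_of_dev_image M hm π P hdev)) hnot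


/-- SparsityDial «MovingPointers» helper `anyS_of_any` (decomp-qadv lens-2 g18 land package; see the module docstring). -/
theorem anyS_of_any (h : AffinePointersLoss3) : AffinePointersLossS3 := by
  obtain ⟨C, hC⟩ := h
  intro c
  obtain ⟨n₀, hn₀⟩ := hC c
  exact ⟨C, n₀, fun n hn t ht m hm M π h1 h2 P _ _ hdev => hn₀ n hn t ht m hm M π h1 h2 P hdev⟩

/-- **S decided on the whole AFFINE-LOOKUP sub-class (no separation): `AffinePointersLossS3` PROVED.** -/
theorem affinePointersLossS3 : AffinePointersLossS3 := anyS_of_any affinePointersLoss3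

end AnySRung

/-- info: 'Summit.QuantumAdvantage.QuantumAdvantage.Theorems.SparsityDial.affinePointers_loss' depends on axioms: [propext,
 Classical.choice,
 Quot.sound] -/
#guard_msgs in #print axioms affinePointers_loss
/-- info: 'Summit.QuantumAdvantage.QuantumAdvantage.Theorems.SparsityDial.affinePointersLoss3' depends on axioms: [propext,
 Classical.choice,
 Quot.sound] -/
#guard_msgs in #print axioms affinePointersLoss3
/-- info: 'Summit.QuantumAdvantage.QuantumAdvantage.Theorems.SparsityDial.affinePointersLossS3' depends on axioms: [propext,
 Classical.choice,
 Quot.sound] -/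
#guard_msgs in #print axioms affinePointersLossS3
/-- info: 'Summit.QuantumAdvantage.QuantumAdvantage.Theorems.SparsityDial.multi_of_any' depends on axioms: [propext,
 Classical.choice,
 Quot.sound] -/
#guard_msgs in #print axioms multi_of_any
/-- info: 'Summit.QuantumAdvantage.QuantumAdvantage.Theorems.SparsityDial.exists_shift_even' depends on axioms: [propext,
 Classical.choice,
 Quot.sound] -/
#guard_msgs in #print axioms exists_shift_even


end Summit.QuantumAdvantage.QuantumAdvantage.Theorems.SparsityDial
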